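import Literature.MathematicalPhysics.QuantumFieldTheory.SlabTransferKernel
import Literature.Analysis.OperatorTheory.CyclicKernelClustering
import HarnessLib

/-!
# Exponential clustering in time of the finite-temperature Wilson lattice gauge theory at fixed
# spatial lattice, uniformly in the temporal extent — PROVED

Topic `Literature/MathematicalPhysics/QuantumFieldTheory`; combines the transfer-matrix representation
of the periodic-time Wilson ensemble (`SlabTransferKernel.integral_obs_mul_weight_eq_integral_sliceKernel`:
`∫ Ψ e^{−S} dU = ∫ Ψ(V) ∏_t sliceKernel(V t, V (t+1)) dV`, the kernel continuous, symmetric, strictly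
positive, independent of `L₀`) with the abstract transfer-operator theorem
`Literature.Analysis.OperatorTheory.exists_cyclic_clustering_zmod` (Jentzsch's gap ⇒ exponential
clustering of cyclic positive-kernel chains with period-independent constants) into
`exists_slice_time_clustering` (**main**): at FIXED spatial box `(ℤ/L)^d`, group, representation and
couplings there are `c > 0`, `C₀` such that for EVERY temporal extent `L₀`, every separation
`n ≤ L₀/2` and all continuous slice observables the connected time correlation in
`FiniteTemperature.expectation ρ J_E J_M` is `≤ C₀ ‖F₁‖_∞ ‖F₂‖_∞ e^{−c n}` — "the transfer matrix of a
finite lattice gauge theory has a gap" (Osterwalder–Seiler 1978 §2–3; Seiler LNP 159 §2), with the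
uniformity in `L₀` made explicit. Nothing is claimed about the dependence of `c`, `C₀` on `L` or the
couplings (that is the continuum-limit / infinite-volume problem). No definitions. [folklore]
-/

noncomputable section

open MeasureTheory Filter Topology Function
open Literature.Barriers.QuantumFields

namespace Literature.MathematicalPhysics.QuantumFieldTheory

variable {d L : ℕ} {G : Type*} [Group G] [TopologicalSpace G] [IsTopologicalGroup G] [CompactSpace G]
  [MeasurableSpace G] [BorelSpace G] [SecondCountableTopology G] {N : ℕ}
  (ρ : G →* Matrix (Fin N) (Fin N) ℂ)

/-- **Transfer-matrix gap of a finite lattice gauge theory (time clustering, uniform in `L₀`).**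
For a continuous unitary matrix representation `ρ` of a compact second-countable group `G`,
couplings `J_E, J_M` and a FIXED spatial box `(ℤ/L)^d`, there are `c > 0` and `C₀` such that for
every temporal extent `L₀ = k + 1 + n' + 1`, every separation `n' + 1 ≤ L₀/2` and all continuous
observables `F₁`, `F₂` of the spatial links of one slice (`|Fᵢ| ≤ Bᵢ`), the connected
correlation of `F₁` read on the slice `t = 0` and `F₂` read on the slice `t = n' + 1` in the
periodic-time Wilson ensemble `FiniteTemperature.expectation ρ J_E J_M` satisfies
`|⟨F₁ F₂⟩ − ⟨F₁⟩⟨F₂⟩| ≤ C₀ B₁ B₂ e^{−c (n'+1)}` — the constants do not depend on `L₀`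
(transfer-matrix representation `integral_obs_mul_weight_eq_integral_sliceKernel` + Jentzsch's gap
`Literature.Analysis.OperatorTheory.exists_cyclic_clustering_zmod` for the continuous, symmetric,
strictly positive `sliceKernel`). The rate `c` is the spectral gap `log(λ/θ)` of the transfer
operator; nothing is claimed about its dependence on `L`, `ρ`, `J_E`, `J_M`.
[cite: OsterwalderSeiler1978, §2–3] -/
theorem exists_slice_time_clustering [NeZero L] (hρ : Continuous ρ)
    (hρu : ∀ g, ρ g ∈ Matrix.unitaryGroup (Fin N) ℂ) (JE JM : ℝ) :
    ∃ c C₀ : ℝ, 0 < c ∧ 0 ≤ C₀ ∧ ∀ (k n' : ℕ), n' ≤ k →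
      ∀ (F₁ F₂ : ((Fin d → ZMod L) × Fin d → G) → ℝ), Continuous F₁ → Continuous F₂ →
      ∀ (B₁ B₂ : ℝ), (∀ a, ‖F₁ a‖ ≤ B₁) → (∀ a, ‖F₂ a‖ ≤ B₂) →
      |FiniteTemperature.expectation ρ JE JM
            (fun U : FiniteTemperature.Config d (k + 1 + n' + 1) L G =>
              F₁ (fun q => U (((0 : ZMod (k + 1 + n' + 1)), q.1), some q.2)) *
              F₂ (fun q => U ((((n' + 1 : ℕ) : ZMod (k + 1 + n' + 1)), q.1), some q.2))) -
          FiniteTemperature.expectation ρ JE JM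
            (fun U : FiniteTemperature.Config d (k + 1 + n' + 1) L G =>
              F₁ (fun q => U (((0 : ZMod (k + 1 + n' + 1)), q.1), some q.2))) *
          FiniteTemperature.expectation ρ JE JM
            (fun U : FiniteTemperature.Config d (k + 1 + n' + 1) L G =>
              F₂ (fun q => U ((((n' + 1 : ℕ) : ZMod (k + 1 + n' + 1)), q.1), some q.2)))| ≤
        C₀ * B₁ * B₂ * Real.exp (-(c * (n' + 1))) := by
  set K := sliceKernel (d := d) (L := L) ρ JE JM with hK
  have hKc : Continuous (uncurry K) := continuous_sliceKernel _ hρ JE JM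
  have hKsymm : ∀ a b, K a b = K b a := sliceKernel_symm _ hρu JE JM
  have hKpos : ∀ a b, 0 < K a b := sliceKernel_pos _ hρ JE JM
  obtain ⟨CK, hCK⟩ := exists_sliceKernel_le (d := d) (L := L) ρ hρ JE JM
  set μ : Measure ((Fin d → ZMod L) × Fin d → G) := Measure.pi fun _ => haarProbability G with hμ
  obtain ⟨c, C₀, hc, hC₀, hclus⟩ :=
    Literature.Analysis.OperatorTheory.exists_cyclic_clustering_zmod (μ := μ) hKc.stronglyMeasurable
      hCK hKsymm hKpos
  refine ⟨c, C₀, hc, hC₀, fun k n' hnk F₁ F₂ hF₁ hF₂ B₁ B₂ hB₁ hB₂ => ?_⟩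
  have key := hclus k n' hnk F₁ F₂ hF₁.measurable hF₂.measurable B₁ B₂ hB₁ hB₂
  -- the partition function and the three expectations as cyclic `sliceKernel` chains
  have hZ : ∫ U, FiniteTemperature.weight ρ JE JM U ∂FiniteTemperature.haar d (k + 1 + n' + 1) L G =
      ∫ V, ∏ t, K (V t) (V (t + 1)) ∂(Measure.pi fun _ : ZMod (k + 1 + n' + 1) => μ) := by
    have h := integral_obs_mul_weight_eq_integral_sliceKernel (d := d) (L₀ := k + 1 + n' + 1) (L := L)
      ρ hρ JE JM (fun _ : ZMod (k + 1 + n' + 1) → (Fin d → ZMod L) × Fin d → G => (1 : ℝ))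
      continuous_const
    simp only [one_mul] at h
    rw [hμ, hK]
    exact h
  have hc0 : Continuous fun V : ZMod (k + 1 + n' + 1) → (Fin d → ZMod L) × Fin d → G => V 0 :=
    continuous_apply _
  have hcp : Continuous fun V : ZMod (k + 1 + n' + 1) → (Fin d → ZMod L) × Fin d → G =>
      V ((n' + 1 : ℕ) : ZMod (k + 1 + n' + 1)) := continuous_apply _
  have e : ∀ (Ψ : (ZMod (k + 1 + n' + 1) → (Fin d → ZMod L) × Fin d → G) → ℝ), Continuous Ψ →
      FiniteTemperature.expectation ρ JE JM (fun U : FiniteTemperature.Config d (k + 1 + n' + 1) L G =>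
          Ψ (fun t q => U ((t, q.1), some q.2))) =
        (∫ V, Ψ V * ∏ t, K (V t) (V (t + 1)) ∂(Measure.pi fun _ : ZMod (k + 1 + n' + 1) => μ)) /
          ∫ V, ∏ t, K (V t) (V (t + 1)) ∂(Measure.pi fun _ : ZMod (k + 1 + n' + 1) => μ) := by
    intro Ψ hΨ
    unfold FiniteTemperature.expectation
    rw [hZ, hμ, hK, ← integral_obs_mul_weight_eq_integral_sliceKernel ρ hρ JE JM Ψ hΨ]
  have e1 := e (fun V => F₁ (V 0) * F₂ (V ((n' + 1 : ℕ) : ZMod (k + 1 + n' + 1))))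
    ((hF₁.comp hc0).mul (hF₂.comp hcp))
  have e2 := e (fun V => F₁ (V 0)) (hF₁.comp hc0)
  have e3 := e (fun V => F₂ (V ((n' + 1 : ℕ) : ZMod (k + 1 + n' + 1)))) (hF₂.comp hcp)
  dsimp only at e1 e2 e3
  rw [e1, e2, e3]
  exact key

end Literature.MathematicalPhysics.QuantumFieldTheory

end
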